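import Summits.CriticalPhenomena.PercolationContinuityZ3.Theorems.Transplant.PlanarSkeletonNegDefs
import HarnessLib

/-!
# N2 (the frames-only node), B1 file 1: THE INTERFACE `PlanarSkeletonFrm` — `PlanarSkeletonNeg` WITHOUT the central inversion `neg`
# (translating frames only, NO point symmetry), its cylinders and Φ2, and the forgetful map `PlanarSkeletonNeg.toFrm`

builds on p205010 (kernel theorem, internal audit signed; external expert review pending) — nothing in this file uses p205010.  DEFINITIONS and their
`rfl` reductions only; NO node is stated here (file 2, `PlanarSkeletonFrm1`) and NOTHING is claimed: the frames-only node is OPEN; the N1 / D″ / Conc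
sentences of record (VERDICTS V124 / V110 / V101) are unchanged; Martineau–Tassion 2017 is a SOURCE of the programme, not a result of it.
Lane `prim-bschramm`, seat `prim-bschramm-stmt` (gen 18; typer), authorised by the lead's pre-GO ruling 2026-08-22 13:50:20Z (B1); helper file
(`--supports stmt-CriticalPhenomena-4575 --as helper`); design memo HOME/N2-SCOPE.md (p3 lineage) §1, typer's census HOME/prim-bschramm-stmt-g18/N2-STMT-CENSUS.md.
* `PlanarSkeletonFrm G` — the EIGHT fields `φ`, `lip`, `types`, `frame`, (μ) `Δ`/`degree_le`, (ι) `step`, (κ) `cyl_connected` of `PlanarSkeletonNeg`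
  (PlanarSkeletonNegDefs :50–:57, :60–:67) VERBATIM; the field `neg` is deleted and nothing replaces it;
* `PlanarSkeletonFrm.cyl`, `PlanarSkeletonFrm.CylSubcritical` — verbatim bodies of the `PlanarSkeletonNeg` versions;
* `PlanarSkeletonNeg.toFrm` (forget `neg`; `toFrm_cyl`, `toFrm_types`, `toFrm_φ`, `cylSubcritical_toFrm_iff`) — so the forgetful chain reads
  `PlanarSkeletonConc → PlanarSkeletonSign → PlanarSkeletonNeg → PlanarSkeletonFrm` and every earlier customer is a customer of the frames-only node.
WHO CARRIES A `PlanarSkeletonFrm` BUT NO `PlanarSkeletonNeg` (N2-SCOPE §7, arguments of the p3/p5/p1 lineages, instances typed elsewhere): the graphical regular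
representation `Cay(H₃(ℤ); a, b, ab, ba²)` (after the automorphism `a ↦ a, b ↦ a⁻¹b`), Cayley graphs `Cay(Γ; S)` of groups with a homomorphism onto `ℤ²`,
finitely generated kernel and tube cylinders with NO `S`-preserving chart-reversing automorphism, vertex-transitive Archimedean stackings without mirrors.
[cite: KozmaNitzan2024, §4 pp. 15–16 (boxes and their translates; Lemma 8: the role of the lattice symmetries)] [cite: MartineauTassion2017, §3.2]
[cite: BenjaminiSchramm1996, Conj. 4] [cite: MartineauSevero2019, Cor. 2.2]
-/

noncomputable section

namespace Summit.CriticalPhenomena.PercolationContinuityZ3.Theorems.Transplant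

open MeasureTheory Literature.Probability.Percolation Literature.Probability.LatticeModels
open scoped Classical

/-- **Planar skeleton with translating frames only** (interface of the frames-only node N2): a sup-norm 1-Lipschitz `φ : V → ℤ²`, finitely many
base vertices, translating frames, the degree bound (μ), outward unit steps (ι) and connected induced cylinders (κ) — and NO point symmetry at all
(neither the central inversion of `PlanarSkeletonNeg` nor the axis flip of `PlanarSkeletonSign`).  Strictly weaker than `PlanarSkeletonNeg` (`toFrm`).
[cite: KozmaNitzan2024, §4 p. 16 (Lemma 8: the lattice symmetries)] [cite: MartineauTassion2017, §3.2] -/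
structure PlanarSkeletonFrm {V : Type} (G : SimpleGraph V) [G.LocallyFinite] where
  /-- the skeleton map `φ : V → ℤ²` -/
  φ : V → Site 2
  /-- `φ` is 1-Lipschitz in the sup-norm along edges -/
  lip : ∀ ⦃u v : V⦄, G.Adj u v → ∀ i : Fin 2, |φ u i - φ v i| ≤ 1
  /-- finitely many base vertices (one per frame type) -/
  types : Finset V
  /-- FRAMES: every vertex is the image of a base vertex under an automorphism translating the skeleton -/
  frame : ∀ v : V, ∃ t ∈ types, ∃ α : G ≃g G, α t = v ∧ ∀ w, φ (α w) = φ w + (φ v - φ t)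
  /-- (μ) a degree bound -/
  Δ : ℕ
  /-- every vertex has degree `≤ Δ` -/
  degree_le : ∀ v : V, G.degree v ≤ Δ
  /-- (ι) outward unit steps in every skeleton direction at every vertex -/
  step : ∀ (v : V) (i : Fin 2) (σ : ℤˣ), ∃ v' : V, G.Adj v v' ∧ φ v' = φ v + Pi.single i (σ : ℤ)
  /-- (κ) the graph induced on each cylinder at a base vertex, `ℓ ≥ 1`, is connected -/
  cyl_connected : ∀ t ∈ types, ∀ ℓ : ℕ, 1 ≤ ℓ → (G.induce {w | φ w - φ t ∈ box 2 ℓ}).Connected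

namespace PlanarSkeletonFrm

variable {V : Type} {G : SimpleGraph V} [G.LocallyFinite] (Φ : PlanarSkeletonFrm G)

/-- Cylinder of half-width `ℓ` at `t` (all fibres over the skeleton box; verbatim `PlanarSkeletonNeg.cyl`). [cite: KozmaNitzan2024, §4 p. 15 (boxes)] -/
def cyl (t : V) (ℓ : ℕ) : Set V := {w | Φ.φ w - Φ.φ t ∈ box 2 ℓ}

/-- **Input Φ2 at density `p`**: the induced graph of every cylinder at a base vertex has `θ = 0` at `p` (verbatim `PlanarSkeletonNeg.CylSubcritical`;
the centre lies in its cylinder since `φ t − φ t = 0 ∈ Λ_ℓ`). [cite: MartineauSevero2019, Cor. 2.2] -/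
def CylSubcritical (p : unitInterval) : Prop :=
  ∀ t ∈ Φ.types, ∀ ℓ : ℕ,
    theta (G.induce (Φ.cyl t ℓ)) ⟨t, show Φ.φ t - Φ.φ t ∈ box 2 ℓ by rw [sub_self]; exact zero_mem_box 2 ℓ⟩ p = 0

/-- Membership in a cylinder. [folklore] -/
theorem mem_cyl {t : V} {ℓ : ℕ} {w : V} : w ∈ Φ.cyl t ℓ ↔ Φ.φ w - Φ.φ t ∈ box 2 ℓ := Iff.rfl

end PlanarSkeletonFrm

namespace PlanarSkeletonNeg

variable {V : Type} {G : SimpleGraph V} [G.LocallyFinite] (Φ : PlanarSkeletonNeg G)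

/-- **Every `PlanarSkeletonNeg` is a `PlanarSkeletonFrm`**: keep everything but the central inversion. [cite: KozmaNitzan2024, §4 p. 16 (Lemma 8)] -/
def toFrm : PlanarSkeletonFrm G where
  φ := Φ.φ
  lip := Φ.lip
  types := Φ.types
  frame := Φ.frame
  Δ := Φ.Δ
  degree_le := Φ.degree_le
  step := Φ.step
  cyl_connected := Φ.cyl_connected

/-- The cylinders of `toFrm` are the cylinders of the skeleton. [folklore] -/
@[simp] theorem toFrm_cyl (t : V) (ℓ : ℕ) : Φ.toFrm.cyl t ℓ = Φ.cyl t ℓ := rfl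

/-- The base vertices of `toFrm` are those of the skeleton. [folklore] -/
@[simp] theorem toFrm_types : Φ.toFrm.types = Φ.types := rfl

/-- The skeleton map of `toFrm` is that of the skeleton. [folklore] -/
@[simp] theorem toFrm_φ : Φ.toFrm.φ = Φ.φ := rfl

/-- The degree bound of `toFrm` is that of the skeleton. [folklore] -/
@[simp] theorem toFrm_Δ : Φ.toFrm.Δ = Φ.Δ := rfl

/-- Cylinder subcriticality is the same statement for `toFrm`. [folklore] -/
theorem cylSubcritical_toFrm_iff (p : unitInterval) : Φ.toFrm.CylSubcritical p ↔ Φ.CylSubcritical p := Iff.rfl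

end PlanarSkeletonNeg

end Summit.CriticalPhenomena.PercolationContinuityZ3.Theorems.Transplant

end
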